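import Summits.BirchSwinnertonDyer.BirchSwinnertonDyer.Theorems.InertBadSignedBranchesInertBadAtThreeIstarZeroOddMissingInput
import Summits.BirchSwinnertonDyer.BirchSwinnertonDyer.Theorems.InertBadSignedBranchesPrintReadingsOfLiterature
import HarnessLib

/-!
# Route `InertBadSignedBranches` (rung K8), D71 child `InertBadAtThreeIstarZero` — the odd-`p` pair
# chain WITHOUT the `ℚ(√p*)`-form of (C1_η): exact reading, (C3_η) at the pair and `BSD(W, p)` from
# Kobayashi Thm. 7.4 at `η` (NAMED FACT) + the even main conjecture at `η` in Kobayashi's own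
# `K_∞`-form (file 1/2; helper `--supports stmt-BirchSwinnertonDyer-19656`; cell `bsd-cm`, seat
# `bsd-cm-k8i-c41` gen 2; theorems only, nothing asserted)

HONEST FRAMING (cell `bsd-cm`, `run/shared/lean/pub/bsd-cm/`): Birch–Swinnerton-Dyer is NOT proved
by any of this; the item (the `3`-part of BSD for every rank-one CM curve of signed local type
`(3, I₀*)`) is OPEN in print; every theorem below is CONDITIONAL on displayed hypotheses; the class
served (O10-PS@3, and O10-PS at `p ≥ 5` since everything here is stated at an arbitrary odd `p`)
stays CONSTRUCTION-SHAPED; 0 definitions, 0 named facts minted, 0 `sorry`; no label moves.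

PARTITION (D-0054): CornerF inert-bad (B12 / O10) × O10-PS (signed type `(p, I₀*)`, `p` odd; at
`p = 3`: 57 rank-one classes) × `p` inert — types-the-object-of; closes no cell, books nothing.

## The point of this file (one binder fewer)

In the landed odd-`p` chain of the seat bsd-cm-inert (p410048 / p410975:
`InertBadOdd.exactControlValue_of_readings_of_ne_two` → `bsdp_of_pairValuation_of_readings_of_ne_two`
→ `missingInputAt_IstarZero_of_pairLaw_of_readings_of_ne_two`) the conjecture-grade input (C1_η)
enters TWICE: as the `ℚ(√p*)`-subtower statement `Additive.QuadraticBranchPlusMainConjectureAt V p`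
(`hC1`, reading flag `Kob03-MC-eta-quadratic-subtower`) and — through the exact-reading text `h74x`,
whose binder `QuadraticBranchPlusMainConjectureAt V p →` is where `hC1` is CONSUMED — implicitly in
whatever proves `h74x`. Inspection of the kernel terms shows that `hC1` is used ONLY to feed that
binder of `h74x` (`exactControlValue_of_readings_of_ne_two`, the line producing `hchar`). Since the
exact reading follows from the NAMED fact Kobayashi 2003 Thm. 7.4 at `η`
(`Kobayashi2003.thm74_etaEvenMC_iff_etaOddMC`, p419059) and the even main conjecture at `η` for the
CM twin in Kobayashi's OWN `K_∞`-form (`hC1K`; VERBATIM §4 p. 8 "`Char(X⁺(E/K_∞)^η) = (L_p⁺(E, η, X))`";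
for CM `V` = Pollack–Rubin's p. 448 REMARK, conjecture-grade by content, carried), the chain can be
run with the `h1`-free reading: this file re-derives its three pair-level links with that one change
(proof bodies otherwise verbatim, credited line by line). Net effect for the item and for the
`p ≥ 5` cone alike: the `ℚ(√p*)`-form of (C1_η) and its reading flag LEAVE the displayed inputs; the
ONLY conjecture-grade input left is Kobayashi's printed even main conjecture at `η` for CM curves.

* `exactReadingAt_of_kobayashi74_of_plusMCEtaK` — the `h1`-free exact strict-minus reading on the type
  at an odd `p`, from `h74` (named fact) and `hC1K` (at this `p`);
* `exactControlValue_of_exactReading_of_ne_two` — (C3_η) at the pair (strict Selmer finite and the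
  valuation identity), bsd-cm-inert's theorem with the `h1`-free reading;
* `bsdp_of_pairValuation_of_exactReading_of_ne_two` — `BSD(W, p)` from the pair VALUES of the law,
  the readings and the published facts, WITHOUT (C1_η) in `ℚ(√p*)`-form.
File 2/2 (`…InertBadAtThreeIstarZeroOfEtaMC.lean`) lifts this to the type and to the item at `p = 3`.

References (locators only): [Kobayashi2003] §4 (p. 8), Thm. 7.4 (p. 13), Thm. 9.3 (p. 26);
[KitajimaOtsuki2018] Main Thm. 1.3; [PollackRubin2004] Theorem and remark (p. 448); [MilneADT2006]
I.4.10; [GrossZagier1986] I.(7.3); [Miller2011LMS] §1, Def. 1.1.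
-/

set_option autoImplicit false
set_option linter.dupNamespace false

noncomputable section

open scoped Classical NumberField
open CongruenceSubgroup Field Function NumberField IsDedekindDomain IsDedekindDomain.HeightOneSpectrum
  WeierstrassCurve Rat.HeightOneSpectrum
open Literature.NumberTheory.EllipticCurves
open Literature.NumberTheory.EllipticCurves.ModularForms
open Literature.NumberTheory.EllipticCurves.Rank1Residual
open Literature.NumberTheory.EllipticCurves.Rank1Residual.Typed
open Literature.NumberTheory.GaloisRepresentations
open Literature.NumberTheory.GaloisCohomology
open Literature.NumberTheory.EllipticCurves.IwasawaAlgebra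
open ZpExtension
open Summit.BirchSwinnertonDyer.Rank1Residual
open Summit.BirchSwinnertonDyer.Rank1Residual.Additive
open Summit.BirchSwinnertonDyer.Rank1Residual.Additive.LevelBridge
open Summit.BirchSwinnertonDyer.Rank1Residual.X12
open Summit.BirchSwinnertonDyer.Rank1Residual.X12.O10
open Summit.BirchSwinnertonDyer.BirchSwinnertonDyer.Theorems.InertBadOdd
open Summit.BirchSwinnertonDyer.BirchSwinnertonDyer.Theorems.PrintReadingsOfLiterature

namespace Summit.BirchSwinnertonDyer.BirchSwinnertonDyer.Theorems.InertBadOddEta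

variable (W : WeierstrassCurve ℚ) [W.IsElliptic] (p : ℕ) [hp : Fact p.Prime]

/-! ## §1 The `h1`-free exact reading on the type from Kobayashi Thm. 7.4 (η) + the even MC at `η` -/

/-- **Kobayashi Thm. 7.4 (ii) EXACT on the type `(p, I₀*)` at an odd `p`, with NO `ℚ(√p*)`-form
hypothesis**, from the named fact `h74` (Thm. 7.4 at `η`: even MC at `η` on `X⁺(V/K_∞)^η` ⟺ odd MC
at `η` on `X⁻(V/K_∞)^η`) and `hC1K` = at this `p`, for every CM `V` good at `p` with `a_p(V) = 0`,
the even main conjecture at `η` on the `η`-component object (VERBATIM §4 p. 8; conjecture-grade,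
carried). For `W` of the type with `r_an(W) = 1`, a good `a_p = 0` twin `V = C • W^{(p*)}` (CM: same
`j`), its newform `f`, period scalar `ϖ`, minus branch `L_η = X·L'`: `char 𝒳⁻_str(W) = (L')` on every
strict-minus dual datum (x1b's dictionary `StrictSignedSelmerDualData.toEtaSigned`, `K₀ = ℚ(μ_p)`,
`θ² = p*`, `γ ↦ γ' ∈ Gal(ℚ̄/K₀)`; the typer's §4 argument, p420699). CONDITIONAL.
[cite: Kobayashi2003, §4 (p. 8), Thm. 7.4 (p. 13)]
[cite: PollackRubin2004, Theorem and the remark on Sel over ℚ(μ_{p^∞}) (p. 448)] -/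
theorem exactReadingAt_of_kobayashi74_of_plusMCEtaK (hp2 : p ≠ 2)
    (h74 : Kobayashi2003.thm74_etaEvenMC_iff_etaOddMC)
    (hC1K : ∀ (K₀ : Type) [Field K₀] [NumberField K₀] [IsCyclotomicExtension {p} ℚ K₀]
        [(galRange (K := ℚ) K₀).Normal] (ηχ : absoluteGaloisGroup ℚ →* ℤˣ),
        (∀ σ ∈ galRange (K := ℚ) K₀, ηχ σ = 1) → ηχ ≠ 1 →
      ∀ (V : WeierstrassCurve ℚ) [V.IsElliptic] [V.IsGloballyMinimal] {N : ℕ} [NeZero N]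
        {f : CuspForm (Gamma0 N) 2}, V.HasCM →
        p ≠ 2 → V.HasGoodReductionAtPrime p → V.frobeniusTrace p = 0 → IsNewformOf V f →
      ∀ (ϖ : ℚ), (if Even (p / 2) then (ϖ : ℝ) * V.realPeriodRat = plusPeriod f
          else (ϖ : ℝ) * V.imaginaryPeriodRat = minusPeriod f) →
      ∀ (κ : ZpExtension ℚ p) (γ : absoluteGaloisGroup ℚ),
        κ.IsCyclotomic → κ.IsTopGenerator γ → γ ∈ galRange (K := ℚ) K₀ → IsCyclotomicVariable p γ →
      ∀ (Lp : IwasawaAlgebra p), Additive.IsQuadraticBranchPlusLFunction f p ϖ Lp →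
      ∀ D : Additive.EtaSignedSelmerDualData V κ K₀ ℚ_[p] ηχ γ 1,
        D.charIdeal = Ideal.span {Lp})
    {W : WeierstrassCurve ℚ} [W.IsElliptic] [W.IsGloballyMinimal]
    (hT : HasSignedLocalType W p (.Istar 0)) :
    ∀ (V : WeierstrassCurve ℚ) [V.IsElliptic] [V.IsGloballyMinimal] (C : VariableChange ℚ)
      {N : ℕ} [NeZero N] {f : CuspForm (Gamma0 N) 2},
      p ≠ 2 → C • W.quadraticTwist ((-1) ^ (p / 2) * p) = V →
      V.HasGoodReductionAtPrime p → V.frobeniusTrace p = 0 → IsNewformOf V f →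
      ∀ (ϖ : ℚ), (if Even (p / 2) then (ϖ : ℝ) * V.realPeriodRat = plusPeriod f
          else (ϖ : ℝ) * V.imaginaryPeriodRat = minusPeriod f) →
      ∀ (Lη : IwasawaAlgebra p), IsQuadraticBranchMinusLFunction f p ϖ Lη →
      ∀ (κ : ZpExtension ℚ p) (γ : Field.absoluteGaloisGroup ℚ),
        κ.IsCyclotomic → κ.IsTopGenerator γ → IsCyclotomicVariable p γ →
      ∀ (D : StrictSignedSelmerDualData W κ ℚ_[p] γ (-1)) (L' : IwasawaAlgebra p),
        Lη = PowerSeries.X * L' → D.charIdeal = Ideal.span {L'} := by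
  -- the typer's §4 argument (p420699 `printReadingsInert_of_plusMCEtaCM`), `5 ≤ p` ↦ `p ≠ 2`, no `h1`
  intro V _ _ C N _ f _ hCV hgood hap hf ϖ hϖ Lη hL κ γ hκ hγ hγc D L' hLL'
  haveI : NeZero p := ⟨(Fact.out : p.Prime).ne_zero⟩
  haveI : IsCyclotomicExtension {p} ℚ (CyclotomicField p ℚ) :=
    CyclotomicField.isCyclotomicExtension p ℚ
  haveI : (galRange (K := ℚ) (CyclotomicField p ℚ)).Normal := normal_galRange_cyclotomic p _
  obtain ⟨θ, ηθ, hθ, hc, hη, hηK, hη1⟩ := SignedTwist.exists_theta_eta_cyclotomicField p hp2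
  have hD := SignedTwist.localTowerHyp_padic p κ (CyclotomicField p ℚ) hκ
  have hκ₀ := kappa_surjOn_galRange_cyclotomic κ (CyclotomicField p ℚ)
  have hcop := coprime_index_galRange_cyclotomic p (CyclotomicField p ℚ)
  obtain ⟨γ', hγ'K, hγ'κ⟩ := hκ₀ (κ γ)
  have hγγ' : γ⁻¹ * γ' ∈ κ.kerSubgroup := by
    rw [ZpExtension.mem_kerSubgroup, map_mul, map_inv, hγ'κ, inv_mul_cancel]
  have hγ' : κ.IsTopGenerator γ' := by rw [ZpExtension.IsTopGenerator, hγ'κ]; exact hγ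
  have hγ'c : IsCyclotomicVariable p γ' :=
    SignedTwist.isCyclotomicVariable_of_inv_mul_mem_ker hκ hγγ' hγc
  have hCMV : V.HasCM := hasCM_of_smul_quadraticTwist_eq (Additive.pStar_ne_zero p) hCV hT.1
  have hEven := hC1K (CyclotomicField p ℚ) ηθ hηK hη1 V hCMV hp2 hgood hap hf ϖ hϖ κ γ' hκ hγ'
    hγ'K hγ'c
  have hOdd := (kobayashi74Text_of_fact p h74 (CyclotomicField p ℚ) ηθ hηK hη1 V hp2 hgood hap hf
    ϖ hϖ κ γ' hκ hγ' hγ'K hγ'c).mp hEven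
  have h := hOdd Lη hL
    (D.toEtaSigned W (CyclotomicField p ℚ) hθ hc p κ hCV ηθ hη ℚ_[p] hD hκ₀ hcop hγ'K hγγ') L' hLL'
  rwa [StrictSignedSelmerDualData.toEtaSigned_charIdeal] at h

/-! ## §2 (C3_η) at the pair and `BSD(W, p)` from the `h1`-free exact reading -/

section BSDpPair

variable {p}
variable [W.IsGloballyMinimal] {V : WeierstrassCurve ℚ} [V.IsElliptic] [V.IsGloballyMinimal]
  {C : VariableChange ℚ} {N : ℕ} [NeZero N] {f : CuspForm (Gamma0 N) 2} {ϖ : ℚ} {L : IwasawaAlgebra p}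
  {P : W.toAffine.Point} {n : ℕ}

/-- **(C3_η) AT THE PAIR at any ODD `p` from the `h1`-FREE exact reading**: `Sel_str(W/ℚ)[p^∞]` finite
and `ord_p #Sel_str + n + ord_p(Tam(W)/#W(ℚ)_tors²) = v_p(coeff₁ L)`, from `hPT`, GZK, the typed
reading (R2) `OddBranchStrictMinusNoFiniteSubmoduleAt W p` and the exact reading `hX` (no
`QuadraticBranchPlusMainConjectureAt` binder). bsd-cm-inert's
`InertBadOdd.exactControlValue_of_readings_of_ne_two` (p410975) with that one change; proof verbatim
otherwise. CONDITIONAL; nothing asserted about the printed theorems.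
[cite: Kobayashi2003, Thm. 7.4 (p. 13), §4 (p. 8), Thm. 9.3 (p. 26)]
[cite: KitajimaOtsuki2018, Main Thm. 1.3 (arXiv:1607.03612 p. 3)] [cite: MilneADT2006, Ch. I, Thm. 4.10] -/
theorem exactControlValue_of_exactReading_of_ne_two
    (hPT : poitouTate_selmerStructure_duality_real ℚ)
    (hGZK : rank_eq_analyticRank_of_analyticRank_le_one)
    (hR2 : OddBranchStrictMinusNoFiniteSubmoduleAt W p)
    (hX : ∀ (V : WeierstrassCurve ℚ) [V.IsElliptic] [V.IsGloballyMinimal] (C : VariableChange ℚ)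
        {N : ℕ} [NeZero N] {f : CuspForm (Gamma0 N) 2},
        p ≠ 2 → C • W.quadraticTwist ((-1) ^ (p / 2) * p) = V →
        V.HasGoodReductionAtPrime p → V.frobeniusTrace p = 0 → IsNewformOf V f →
        ∀ (ϖ : ℚ), (if Even (p / 2) then (ϖ : ℝ) * V.realPeriodRat = plusPeriod f
            else (ϖ : ℝ) * V.imaginaryPeriodRat = minusPeriod f) →
        ∀ (Lη : IwasawaAlgebra p), IsQuadraticBranchMinusLFunction f p ϖ Lη →
        ∀ (κ : ZpExtension ℚ p) (γ : Field.absoluteGaloisGroup ℚ),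
          κ.IsCyclotomic → κ.IsTopGenerator γ → IsCyclotomicVariable p γ →
        ∀ (D : StrictSignedSelmerDualData W κ ℚ_[p] γ (-1)) (L' : IwasawaAlgebra p),
          Lη = PowerSeries.X * L' → D.charIdeal = Ideal.span {L'})
    (hp2 : p ≠ 2)
    (hv0 : padicValNat p ((W.baseChange (((primesEquiv (R := 𝓞 ℚ)).symm ⟨p, hp.out⟩).adicCompletion ℚ)).localTamagawaNumber
      (((primesEquiv (R := 𝓞 ℚ)).symm ⟨p, hp.out⟩).adicCompletionIntegers ℚ)) = 0)
    (hCV : C • W.quadraticTwist ((-1) ^ (p / 2) * p) = V)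
    (hgood : V.HasGoodReductionAtPrime p) (hap : V.frobeniusTrace p = 0) (hr : W.analyticRank = 1)
    (hf : IsNewformOf V f)
    (hϖ : if Even (p / 2) then (ϖ : ℝ) * V.realPeriodRat = plusPeriod f
        else (ϖ : ℝ) * V.imaginaryPeriodRat = minusPeriod f)
    (hL : IsQuadraticBranchMinusLFunction f p ϖ L)
    (htors : ∀ Q : (W.baseChange ℚ_[p]).toAffine.Point, p • Q = 0 → Q = 0)
    (hP : ¬ IsOfFinAddOrder P)
    (hgen : ∀ R : W.toAffine.Point, ∃ (k : ℤ) (T : W.toAffine.Point),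
      IsOfFinAddOrder T ∧ R = k • P + T)
    (hdiv : ∃ Q : (W.baseChange ℚ_[p]).toAffine.Point, p ^ n • Q = W.toPadicPoint p P)
    (hndiv : ∀ Q : (W.baseChange ℚ_[p]).toAffine.Point, p ^ (n + 1) • Q ≠ W.toPadicPoint p P) :
    Finite ↥(strictSelmerPInfty W p) ∧
      (padicValNat p (Nat.card ↥(strictSelmerPInfty W p)) : ℤ) + n +
          padicValRat p ((W.tamagawaProduct : ℚ) / (W.torsionOrder : ℚ) ^ 2) =
        ((PowerSeries.coeff 1 L : ℤ_[p]) : ℚ_[p]).valuation := by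
  -- adapted from InertBadOdd.exactControlValue_of_readings_of_ne_two (bsd-cm-inert g10, p410975): `h1` dropped
  set v₀ := (Rat.HeightOneSpectrum.primesEquiv (R := 𝓞 ℚ)).symm ⟨p, hp.out⟩ with hv₀
  obtain ⟨-, hfin⟩ := hGZK W hr.le
  haveI : Finite W.sha := hfin
  haveI hSha : Finite (AddCommGroup.primaryComponent W.sha p) := inferInstance
  obtain ⟨γ, hγ, hχ⟩ := CyclotomicZp.exists_isTopGenerator_zpExtension p
  have hκ := CyclotomicZp.isCyclotomic_zpExtension p
  have hγc : IsCyclotomicVariable p γ := ⟨1, IsOfFinOrder.one, by rw [mul_one]; exact hχ⟩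
  obtain ⟨D⟩ := nonempty_strictSignedSelmerDualData W (CyclotomicZp.zpExtension p) ℚ_[p] (-1) hγ
  obtain ⟨L', hLL', hL'0⟩ := hL.exists_eq_X_mul
  have hchar : D.charIdeal = Ideal.span {L'} :=
    hX V C hp2 hCV hgood hap hf ϖ hϖ L hL _ γ hκ hγ hγc D L' hLL'
  obtain ⟨S, hS⟩ := exists_finset_forall_not_mem_good W p
  have hpT : v₀ ∉ S.erase v₀ := fun h ↦ (Finset.mem_erase.mp h).1 rfl
  have hTmem : ∀ v : HeightOneSpectrum (𝓞 ℚ), v ≠ v₀ →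
      p ∣ (W.baseChange (v.adicCompletion ℚ)).localTamagawaNumber (v.adicCompletionIntegers ℚ) →
        v ∈ S.erase v₀ := by
    intro v hv hdvd
    refine Finset.mem_erase.mpr ⟨hv, ?_⟩
    by_contra hvS
    rw [W.localTamagawaNumber_eq_one_of_hasGoodReductionAt_holds v (hS v hvS).2] at hdvd
    exact hp.out.one_lt.ne' (Nat.dvd_one.mp hdvd)
  have hSel := card_sha_mul_eq_pow_of_oddBranchNoFiniteSubmodule_of_quadraticTwist_signedPrime_rankOne W
    (CyclotomicZp.zpExtension p) hp2 hκ C V hCV hgood hap hPT P hP hgen hdiv hndiv (S.erase v₀) hpT hTmem hγ D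
    hchar hR2
  have hidx := StrictSha.strictSelmerIndexAt_holds W p P n hP hgen htors hdiv hndiv
  have hTamSum := sum_padicValNat_localTamagawaNumber_eq_padicValNat_tamagawaProduct W p (S.erase v₀) hpT
    hTmem hv0
  have htors0 := padicValNat_torsionOrder_eq_zero_of_noPTorsion W p htors
  have hSha0 : Nat.card (AddCommGroup.primaryComponent W.sha p) ≠ 0 := Nat.card_pos.ne'
  have hp0 : p ≠ 0 := hp.out.ne_zero
  rw [Finset.prod_pow_eq_pow_sum, ← pow_add, hTamSum] at hSel
  have hval := congrArg (padicValNat p) hSel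
  rw [padicValNat.mul hSha0 (pow_ne_zero _ hp0), padicValNat.prime_pow, padicValNat.prime_pow] at hval
  have hidxval : padicValNat p (Nat.card ↥(strictSelmerPInfty W p)) =
      n + padicValNat p (Nat.card (AddCommGroup.primaryComponent W.sha p)) := by
    rw [hidx, padicValNat.mul (pow_ne_zero _ hp0) hSha0, padicValNat.prime_pow]
  refine ⟨Nat.finite_of_card_ne_zero (by rw [hidx]; exact mul_ne_zero (pow_ne_zero _ hp0) hSha0), ?_⟩
  have hTamQ : (W.tamagawaProduct : ℚ) ≠ 0 := by exact_mod_cast W.tamagawaProduct_pos_holds.ne'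
  have htQ : (W.torsionOrder : ℚ) ≠ 0 := by exact_mod_cast W.torsionOrder_pos_holds.ne'
  have hrat : padicValRat p ((W.tamagawaProduct : ℚ) / (W.torsionOrder : ℚ) ^ 2) =
      (padicValNat p W.tamagawaProduct : ℤ) := by
    rw [padicValRat.div hTamQ (pow_ne_zero 2 htQ), padicValRat.pow, padicValRat.of_nat, padicValRat.of_nat,
      htors0]
    simp
  have hv' : ((PowerSeries.coeff 1 L : ℤ_[p]) : ℚ_[p]).valuation =
      ((((PowerSeries.constantCoeff L' : ℤ_[p]) : ℚ_[p]).valuation).toNat : ℤ) := by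
    rw [← hL'0]
    exact (Int.toNat_of_nonneg (PadicInt.valuation_coe_nonneg)).symm
  rw [hrat, hv', hidxval, ← hval]
  push_cast
  ring

/-- **`BSD(W, p)` at any ODD `p` from the PAIR VALUES and the `h1`-FREE exact reading**: the law at
the pair (`hv2`), the readings (R2) (typed) and `hX` (exact, no (C1_η) binder), `hmod hGZ hGZK hPT`,
`p ≠ 2`, `ord_p c_p(W) = 0`. bsd-cm-inert's `InertBadOdd.bsdp_of_pairValuation_of_readings_of_ne_two`
with the `h1`-free reading; proof verbatim otherwise. CONDITIONAL; nothing booked.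
[cite: Miller2011LMS, §1 and Def. 1.1] [cite: Kobayashi2003, §4 (p. 8), Thm. 7.4 (p. 13), Thm. 9.3 (p. 26)]
[cite: GrossZagier1986, Thm. I.(7.3) 2) (p. 231)] -/
theorem bsdp_of_pairValuation_of_exactReading_of_ne_two
    (hmod : hasEntireLFunction_rat) (hGZ : GrossZagier1986_thm_I_7_3)
    (hGZK : rank_eq_analyticRank_of_analyticRank_le_one)
    (hPT : poitouTate_selmerStructure_duality_real ℚ)
    (hR2 : OddBranchStrictMinusNoFiniteSubmoduleAt W p)
    (hX : ∀ (V : WeierstrassCurve ℚ) [V.IsElliptic] [V.IsGloballyMinimal] (C : VariableChange ℚ)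
        {N : ℕ} [NeZero N] {f : CuspForm (Gamma0 N) 2},
        p ≠ 2 → C • W.quadraticTwist ((-1) ^ (p / 2) * p) = V →
        V.HasGoodReductionAtPrime p → V.frobeniusTrace p = 0 → IsNewformOf V f →
        ∀ (ϖ : ℚ), (if Even (p / 2) then (ϖ : ℝ) * V.realPeriodRat = plusPeriod f
            else (ϖ : ℝ) * V.imaginaryPeriodRat = minusPeriod f) →
        ∀ (Lη : IwasawaAlgebra p), IsQuadraticBranchMinusLFunction f p ϖ Lη →
        ∀ (κ : ZpExtension ℚ p) (γ : Field.absoluteGaloisGroup ℚ),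
          κ.IsCyclotomic → κ.IsTopGenerator γ → IsCyclotomicVariable p γ →
        ∀ (D : StrictSignedSelmerDualData W κ ℚ_[p] γ (-1)) (L' : IwasawaAlgebra p),
          Lη = PowerSeries.X * L' → D.charIdeal = Ideal.span {L'})
    (hv2 : ∀ q : ℚ, shaAn W = (q : ℂ) →
      PowerSeries.coeff 1 L ≠ 0 ∧
        ((PowerSeries.coeff 1 L : ℤ_[p]) : ℚ_[p]).valuation =
          2 * (n : ℤ) + padicValRat p (q * W.tamagawaProduct / (W.torsionOrder : ℚ) ^ 2))
    (hp2 : p ≠ 2)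
    (hv0 : padicValNat p ((W.baseChange (((primesEquiv (R := 𝓞 ℚ)).symm ⟨p, hp.out⟩).adicCompletion ℚ)).localTamagawaNumber
      (((primesEquiv (R := 𝓞 ℚ)).symm ⟨p, hp.out⟩).adicCompletionIntegers ℚ)) = 0)
    (hCV : C • W.quadraticTwist ((-1) ^ (p / 2) * p) = V)
    (hgood : V.HasGoodReductionAtPrime p) (hap : V.frobeniusTrace p = 0)
    (hf : IsNewformOf V f)
    (hϖ : if Even (p / 2) then (ϖ : ℝ) * V.realPeriodRat = plusPeriod f
        else (ϖ : ℝ) * V.imaginaryPeriodRat = minusPeriod f)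
    (hL : IsQuadraticBranchMinusLFunction f p ϖ L)
    (htors : ∀ Q : (W.baseChange ℚ_[p]).toAffine.Point, p • Q = 0 → Q = 0)
    (hP : ¬ IsOfFinAddOrder P)
    (hgen : ∀ R : W.toAffine.Point, ∃ (k : ℤ) (T : W.toAffine.Point),
      IsOfFinAddOrder T ∧ R = k • P + T)
    (hdiv : ∃ Q : (W.baseChange ℚ_[p]).toAffine.Point, p ^ n • Q = W.toPadicPoint p P)
    (hndiv : ∀ Q : (W.baseChange ℚ_[p]).toAffine.Point, p ^ (n + 1) • Q ≠ W.toPadicPoint p P)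
    (hr : W.analyticRank = 1) : BSDp W p := by
  -- adapted from InertBadOdd.bsdp_of_pairValuation_of_readings_of_ne_two (bsd-cm-inert g10): `h1` dropped
  obtain ⟨hrank, hfin⟩ := hGZK W hr.le
  haveI : Finite W.sha := hfin
  obtain ⟨s, hs⟩ := Disegni2020.exists_rat_shaAn_eq_of_analyticRank_eq_one hGZ hGZK W hr
  have hs0 : s ≠ 0 := by
    rintro rfl
    exact AdditivePotMult.shaAn_ne_zero W hmod (by rw [hs, Rat.cast_zero])
  have hc : (W.tamagawaProduct : ℚ) ≠ 0 := by exact_mod_cast W.tamagawaProduct_pos_holds.ne'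
  have ht : (W.torsionOrder : ℚ) ≠ 0 := by exact_mod_cast W.torsionOrder_pos_holds.ne'
  have hct : (W.tamagawaProduct : ℚ) / (W.torsionOrder : ℚ) ^ 2 ≠ 0 :=
    div_ne_zero hc (pow_ne_zero 2 ht)
  obtain ⟨-, hv2'⟩ := hv2 s hs
  have hsplit : padicValRat p (s * W.tamagawaProduct / (W.torsionOrder : ℚ) ^ 2) =
      padicValRat p s + padicValRat p ((W.tamagawaProduct : ℚ) / (W.torsionOrder : ℚ) ^ 2) := by
    rw [mul_div_assoc, padicValRat.mul hs0 hct]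
  obtain ⟨-, hv3⟩ := exactControlValue_of_exactReading_of_ne_two W hPT hGZK hR2 hX hp2 hv0 hCV hgood hap
    hr hf hϖ hL htors hP hgen hdiv hndiv
  haveI : Finite (AddCommGroup.primaryComponent W.sha p) := inferInstance
  have hI := (StrictSha.strictSelmerIndexAt_holds W p).padicValNat_card_eq hP hgen htors hdiv hndiv
  refine ⟨hrank, inferInstance, s, hs, ?_⟩
  rw [hI, Nat.cast_add] at hv3
  rw [hsplit] at hv2'
  linarith

end BSDpPair

end Summit.BirchSwinnertonDyer.BirchSwinnertonDyer.Theorems.InertBadOddEta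
end
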